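import Summits.BirchSwinnertonDyer.BirchSwinnertonDyer.Theorems.CMKolyvaginAtInertTwoTauPartDescentAtTwoPow
import HarnessLib

/-!
# Route `CMKolyvaginAtInertTwo`, crux `CMKolyvaginExactAtInertTwo` (stmt-BirchSwinnertonDyer-24277):
# THE `ε`-PART TWO-PRIME STEP AT `p = 2`, LEVEL `2^M` — a Selmer class of the SAME sign as `y_K`
# and independent of `δ y_K` is killed by `2^{M−a}` (McCallum §5 / Gross Prop. 2.3 at `2`, one bit lost)

Seat `bsd-line-cmk2-p1` g7 (cell `bsd-print-cf2`); helper (`--supports stmt-BirchSwinnertonDyer-24277`).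
THEOREMS ONLY: no definition, no named fact, no `sorry`; no item is closed; BSD is not proved by this.

`two_pow_smul_selmer_plus_eq_zero_of_indep_two_pow` — hypotheses of `…MinusPartDescentAtTwoPow`
(`ρ̄_{E,2}` onto, `Δ_E < 0`, `Δ_E ∉ K²`, `y_K = P` Heegner of infinite order, `2^a y_K ∉ 2^M E(K)`, the
Cartan-type `z`, binders `hpoints`/`hRT` at `(2, M)`), `ε` the sign of `y_K`: every `s ∈ Sel_{2^M}(E/K)`
with `c_* s = ε s` and **`ℤ s ∩ ℤ δ(y_K) = 0`** satisfies **`2^{M−a} s = 0`**. PROOF (two primes,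
kernel form): FIRST PRIME — `(s, c(1))` is an independent family of `ε`-eigenclasses; the level-`2^M`
Čebotarev leaf with targets `(0, t_c)`, `2^a t_c = v₁` a `τ`-moved `2`-torsion point, gives `ℓ₁` of
depth `M` with `s_{λ₁} = 0`, `(2^a c(1))_{λ₁} ≠ 0`; Gross 6.2 (2) ⟹ `2^a c(ℓ₁) ≠ 0` (not Selmer at
`λ₁`). SECOND PRIME `ℓ₂ > ℓ₁` — bottom bits `u₂ = 2^j·2^{M−a}s` (suppose `≠ 0`), `x₂ = 2^i·2^a c(ℓ₁)`
are `c_*`-fixed; the leaf gives `u_{2,λ₂} ≠ 0 ≠ x_{2,λ₂}`; Gross 6.2 (2) at the composite level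
`ℓ₁ℓ₂` ⟹ `2^{i+a} c(ℓ₁ℓ₂)` not Selmer at `λ₂`; `c(ℓ₁ℓ₂)` is `ε`-eigen, Selmer off `ℓ₁ℓ₂`; `hRT` at
`ℓ₂` with `T = {λ₁}` (as `s_{λ₁} = 0`) and leaf (B) at `2^M` (p612024) give
`2^{M−i−a−1}·2s ∈ ker loc_{λ₂}` ∋ `u₂` — contradiction.
HONEST FRAMING. With `a = M−1−M₀`: order `≤ 2^{M₀+1}` (odd `p`: `p^{M₀}`). The dependent case
(`ℤs ∩ ℤδy_K ≠ 0`, shared bottom bits — a `p = 2` phenomenon) is not treated; the expected synthesis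
with the `(−ε)`-part is the ANNIHILATOR `2^{M₀+2}·Sel_{2^M}(E/K) ⊆ ℤδy_K`, not the order: the
`τ`-invariant order-`2` classes stay invisible (memo §1). Hypotheses at `2` not in print: `hpoints`,
`hRT`, `hcomm`. Refs: [McCallumLMS1991] §5 (5.1–5.4); [GrossLMS1991] Props. 2.1, 2.3, §10.
-/

-- single-conjunct summit: `Summit.BirchSwinnertonDyer.BirchSwinnertonDyer.…` repeats the name by design
set_option linter.dupNamespace false
set_option autoImplicit false

noncomputable section

open scoped Classical
open WeierstrassCurve NumberField IsDedekindDomain Field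
open Literature.NumberTheory.GaloisRepresentations Literature.NumberTheory.EllipticCurves

namespace Summit.BirchSwinnertonDyer.BirchSwinnertonDyer.Theorems.KolyvaginDescentTwo

variable (W : WeierstrassCurve ℚ) {K : Type} [Field K] [NumberField K]

set_option maxHeartbeats 1600000 in
/-- **The `ε`-part two-prime step at `p = 2`, level `2^M`** (module docstring): for
`s ∈ Sel_{2^M}(E/K)` with `c_* s = ε s` (`ε` the sign of `y_K`) and `ℤs ∩ ℤδ(y_K) = 0`:
`2^{M−a} s = 0`, granted `2^a y_K ∉ 2^M E(K)`, the machine's inputs at `(2, M)` and `hcomm`.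
[cite: McCallumLMS1991, §5 Lemma 5.1, Prop. 5.2, Lemma 5.3 (with §2 Prop. 2.2), Thm. 5.4]
[cite: GrossLMS1991, Props. 2.1, 2.3 with §10, (4.4), Props. 5.3, 6.2] -/
theorem two_pow_smul_selmer_plus_eq_zero_of_indep_two_pow {N : ℕ} [NeZero N] [W.IsElliptic]
    (hK : IsImaginaryQuadratic K) {P : (W.baseChange K).toAffine.Point} (hP : IsHeegnerPoint N W K P)
    (hnt : ¬ IsOfFinAddOrder P)
    (hρ : W.HasSurjectiveModNGaloisRep 2) (hΔ : W.Δ < 0) (hΔK : ¬ IsSquare (W.baseChange K).Δ)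
    {c : K ≃ₐ[ℚ] K} (hc : c ≠ 1) {M : ℕ} (hM : 1 ≤ M) {q : ℕ} (hq : q = 2 ^ M)
    {z : absoluteGaloisGroup K}
    (hzfix : ∀ T : geomTorsion (W.baseChange K) ((2 : ℕ) : ℤ), z • T = T → T = 0)
    (hcomm : ∀ π ∈ torsionFixing (W.baseChange K) ((2 : ℕ) : ℤ),
      ∀ T : geomTorsion (W.baseChange K) (q : ℤ), π • z • T = z • π • T)
    {a : ℕ} (ha : a < M)
    (hy : ∀ Q : (W.baseChange K).toAffine.Point, (q : ℤ) • Q ≠ ((((2 : ℕ) : ℤ) ^ a)) • P)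
    {ε : ℤ} (hε : ε = 1 ∨ ε = -1)
    (hPε : IsOfFinAddOrder (Affine.Point.map (W' := W) (c : K →ₐ[ℚ] K) P - ε • P))
    (hpoints : ∀ (hdiv : ∀ Q : geomPoints (W.baseChange K), ∃ R, (q : ℤ) • R = Q),
      ∃ (ε : ℤ) (τ : AlgebraicClosure K ≃+* AlgebraicClosure K) (hτ : IsLiftOfAut c τ)
        (A : ℕ → AddSubgroup (geomPoints (W.baseChange K)))
        (hA : ∀ m, KolyvaginCocycle.IsAdmissible (Field.absoluteGaloisGroup K) (A m) (q : ℤ))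
        (Pt : ℕ → geomPoints (W.baseChange K))
        (hPt : ∀ m, Pt m ∈ KolyvaginCocycle.invPoints (Field.absoluteGaloisGroup K) (A m) (q : ℤ)),
        (ε = 1 ∨ ε = -1) ∧
        IsOfFinAddOrder (Affine.Point.map (W' := W) (c : K →ₐ[ℚ] K) P - ε • P) ∧
        (∀ m, ∀ a ∈ A m, hτ.pointsMap W a ∈ A m) ∧
        Pt 1 = toGeomPoints (W.baseChange K) P ∧
        (∀ m : ℕ, Squarefree m →
          (∀ q' ∈ m.primeFactors, IsKolyvaginPrime N W K 2 q' ∧ FrobEqFrobInfty W K q q') →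
          (∃ B ∈ A m, hτ.pointsMap W (Pt m) =
            (ε * (-1) ^ m.primeFactors.card) • Pt m + (q : ℤ) • B) ∧
          (∀ v : HeightOneSpectrum (𝓞 K), (m : 𝓞 K) ∉ v.asIdeal →
            kolyvaginClass (W.baseChange K) _ hdiv (hA m) (Pt m) (hPt m) ∈
              selmerLocalKer (W.baseChange K) (v.adicCompletion K) (q : ℤ)) ∧
          (∀ ℓ : ℕ, ℓ.Prime → ℓ ∣ m → ∀ v : HeightOneSpectrum (𝓞 K), (ℓ : 𝓞 K) ∈ v.asIdeal →
            ∀ a : ℕ, ((((2 : ℕ) : ℤ) ^ a) •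
                kolyvaginClass (W.baseChange K) _ hdiv (hA m) (Pt m) (hPt m) ∈
                selmerLocalKer (W.baseChange K) (v.adicCompletion K) (q : ℤ) ↔
              (((2 : ℕ) : ℤ) ^ a) • kolyvaginClass (W.baseChange K) _ hdiv (hA (m / ℓ)) (Pt (m / ℓ))
                  (hPt (m / ℓ)) ∈
                (W.baseChange K).torsionLocalKer (v.adicCompletion K) (q : ℤ)))))
    (hRT : ∀ {ℓ : ℕ} (hℓ : IsKolyvaginPrime N W K 2 ℓ), FrobEqFrobInfty W K q ℓ →
      ∃ (A : Type) (_ : AddCommGroup A)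
        (e : geomTorsion (W.baseChange K) (q : ℤ) →+ geomTorsion (W.baseChange K) (q : ℤ) →+ A),
        (∀ x, e x x = 0) ∧ (∀ x, (∀ y, e x y = 0) → x = 0) ∧
        ∀ (T : Finset (HeightOneSpectrum (𝓞 K))),
        ∀ s ∈ selmerGroup (W.baseChange K) (q : ℤ),
          (∀ v ∈ T, s ∈ (W.baseChange K).torsionLocalKer (v.adicCompletion K) (q : ℤ)) →
          ∀ c' : galH1Torsion (W.baseChange K) (q : ℤ),
          (∀ v : HeightOneSpectrum (𝓞 K), v ∉ T → (ℓ : 𝓞 K) ∉ v.asIdeal →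
            c' ∈ selmerLocalKer (W.baseChange K) (v.adicCompletion K) (q : ℤ)) →
          (∀ w : InfinitePlace K, c' ∈ selmerLocalKer (W.baseChange K) w.Completion (q : ℤ)) →
          ∀ 𝔔 ∈ hℓ.place.primesAbove, ∀ F : Field.absoluteGaloisGroup K,
            IsArithFrobAt (𝓞 K) F 𝔔 → F ∈ torsionFixing (W.baseChange K) (q : ℤ) →
            ∀ σ ∈ 𝔔.inertia (Field.absoluteGaloisGroup K),
            e (h1Eval (W.baseChange K) (q : ℤ) s F) (h1Eval (W.baseChange K) (q : ℤ) c' σ) = 0) :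
    ∀ s ∈ selmerGroup (W.baseChange K) (q : ℤ), conjAct W c (q : ℤ) s = ε • s →
      (∀ (hdiv : ∀ Q : geomPoints (W.baseChange K), ∃ R, (q : ℤ) • R = Q) (α β : ℤ),
        α • s + β • kummerMapTorsion (W.baseChange K) (q : ℤ) hdiv P = 0 → α • s = 0) →
      (((2 : ℕ) : ℤ) ^ (M - a)) • s = 0 := by
  subst hq
  classical
  haveI : Fact (Nat.Prime 2) := ⟨Nat.prime_two⟩
  haveI : Algebra.IsQuadraticExtension ℚ K := ⟨hK.1⟩
  haveI : IsTotallyComplex K := hK.2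
  intro s hs hsε hind
  have hq0 : ((2 ^ M : ℕ) : ℤ) ≠ 0 := by exact_mod_cast pow_ne_zero M two_ne_zero
  have h2dvd : 2 ∣ 2 ^ M := dvd_pow_self 2 (Nat.one_le_iff_ne_zero.mp hM)
  -- ### the classes `c(m)` from the points, `c(1) = δ y_K`
  have hdiv : ∀ Q : geomPoints (W.baseChange K), ∃ R, ((2 ^ M : ℕ) : ℤ) • R = Q :=
    (W.baseChange K).zsmul_geomPoints_surjective_holds hq0
  obtain ⟨ε₀, τ, hτ, A, hA, Pt, hPt, hε₀, h53, hAτ, hPt1, hrel⟩ := hpoints hdiv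
  obtain ⟨cl, hcl⟩ : ∃ cl : ℕ → galH1Torsion (W.baseChange K) ((2 ^ M : ℕ) : ℤ),
      ∀ m, cl m = kolyvaginClass (W.baseChange K) _ hdiv (hA m) (Pt m) (hPt m) := ⟨_, fun _ ↦ rfl⟩
  have hP1 : toGeomPoints (W.baseChange K) P ∈
      KolyvaginCocycle.invPoints (Field.absoluteGaloisGroup K) (A 1) ((2 ^ M : ℕ) : ℤ) := hPt1 ▸ hPt 1
  have hc1 : cl 1 = kummerMapTorsion (W.baseChange K) _ hdiv P := by
    rw [hcl 1, KolyvaginDescent.kolyvaginClass_congr_point (hA 1) (hP' := hP1) hPt1]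
    exact kolyvaginClass_toGeomPoints (hA 1) P hP1
  -- ### the sign of the data is `ε`
  have hneg := not_isOfFinAddOrder_map_sub_neg_smul W hnt c hε hPε
  have hεε₀ : ε₀ = ε := by
    rcases hε₀ with rfl | rfl <;> rcases hε with rfl | rfl <;> first | rfl | exact absurd h53 hneg
  rw [← hεε₀] at hsε
  have hεε : ε₀ * ε₀ = 1 := by rcases hε₀ with rfl | rfl <;> norm_num
  -- ### every class is killed by `2^M`; sign-fixing on order-`2` classes
  have hqkill : ∀ y : galH1Torsion (W.baseChange K) ((2 ^ M : ℕ) : ℤ), (((2 : ℕ) : ℤ) ^ M) • y = 0 :=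
    fun y ↦ by rw [← Nat.cast_pow]; exact zsmul_galH1Torsion_eq_zero (W.baseChange K) _ y
  have hsignfix : ∀ {μ : ℤ}, (μ = 1 ∨ μ = -1) →
      ∀ y : galH1Torsion (W.baseChange K) ((2 ^ M : ℕ) : ℤ), ((2 : ℕ) : ℤ) • y = 0 → μ • y = y := by
    intro μ hμ y hy2
    have h : (2 : ℤ) • y = 0 := by exact_mod_cast hy2
    rcases hμ with rfl | rfl
    · rw [one_zsmul]
    · rw [two_zsmul] at h; rw [neg_one_zsmul]; exact neg_eq_of_add_eq_zero_left h
  -- ### `x = 2^a c(1) ≠ 0`, `c_* c(1) = ε c(1)`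
  have hx0 : (((2 : ℕ) : ℤ) ^ a) • cl 1 ≠ 0 := by
    intro h0
    have hker : (((2 : ℕ) : ℤ) ^ a) • P ∈ (kummerMapTorsion (W.baseChange K) _ hdiv).ker := by
      rw [AddMonoidHom.mem_ker, map_zsmul, ← hc1, h0]
    rw [kummerMapTorsion_ker, AddMonoidHom.mem_range] at hker
    obtain ⟨R, hR⟩ := hker
    exact hy R hR
  have hcl10 : cl 1 ≠ 0 := fun h ↦ hx0 (by rw [h]; exact zsmul_zero _)
  have hone : ∀ q' ∈ (1 : ℕ).primeFactors,
      IsKolyvaginPrime N W K 2 q' ∧ FrobEqFrobInfty W K (2 ^ M) q' :=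
    fun q' hq' ↦ absurd hq' (by simp)
  have hx1 : conjAct W c _ (cl 1) = ε₀ • cl 1 := by
    have h := conjAct_kolyvaginClass_eq_smul W (hdiv := hdiv) hτ (hA 1) (hAτ 1) (hPt 1) _
      (hrel 1 squarefree_one hone).1
    rw [← hcl 1, Nat.primeFactors_one, Finset.card_empty, pow_zero, mul_one] at h
    exact h
  -- ### suppose `w = 2^{M-a} s ≠ 0`
  by_contra hw
  have hs0 : s ≠ 0 := fun h ↦ hw (by rw [h]; exact zsmul_zero _)
  -- orders and independence of `(s, c(1))`
  obtain ⟨es, -, -, hes, -, hords⟩ := exists_addOrderOf_eq_pow (W.baseChange K) Nat.prime_two M hs0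
  obtain ⟨ec, -, -, hec, -, hordc⟩ := exists_addOrderOf_eq_pow (W.baseChange K) Nat.prime_two M hcl10
  have heca : a + 1 ≤ ec := by
    by_contra hlt
    apply hx0
    have hle : ec ≤ a := by omega
    obtain ⟨d, hd⟩ := Nat.exists_eq_add_of_le hle
    rw [hd, pow_add, mul_comm, ← smul_smul]
    have hec' : (((2 : ℕ) : ℤ) ^ ec) • cl 1 = 0 := by exact_mod_cast hec
    rw [hec']; exact zsmul_zero _
  have hind2 : ∀ α : Fin 2 → ℤ, ∑ i, α i • ![s, cl 1] i = 0 →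
      ∀ i, (((2 : ℕ) : ℤ) ^ ![es, ec] i) ∣ α i := by
    intro α hα
    rw [Fin.sum_univ_two, Matrix.cons_val_zero, Matrix.cons_val_one, Matrix.cons_val_zero] at hα
    have hαs : α 0 • s = 0 := hind hdiv (α 0) (α 1) (by rwa [← hc1])
    have hαc : α 1 • cl 1 = 0 := by rwa [hαs, zero_add] at hα
    intro i
    fin_cases i
    · have h1 : ((2 ^ es : ℕ) : ℤ) ∣ α 0 := by
        convert addOrderOf_dvd_iff_zsmul_eq_zero.mpr hαs using 2; exact hords.symm
      simpa using h1
    · have h1 : ((2 ^ ec : ℕ) : ℤ) ∣ α 1 := by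
        convert addOrderOf_dvd_iff_zsmul_eq_zero.mpr hαc using 2; exact hordc.symm
      simpa using h1
  -- ### the targets: `v₁ ∈ E[2^M]` of order `2` moved by `τ`, and `t_c = 2^{M-a-1} R`, `2^{M-1} R = v₁`
  have hC := Literature.NumberTheory.Automorphic.chebotarev_artinRep_holds
  obtain ⟨c₀, hc₀⟩ := exists_isComplexConjugation (Rat.castHom ℝ)
  have ht : IsLiftOfAut c (absGaloisTransport (K := ℚ) (L := K) c₀).toRingEquiv :=
    RatClosure.isLiftOfAut_absGaloisTransport_of_isImaginaryQuadratic hK hc hc₀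
  obtain ⟨v₀, hv₀⟩ :=
    Summit.BirchSwinnertonDyer.BirchSwinnertonDyer.Theorems.KolyvaginEigenTwo.exists_twoTorsion_smul_ne_of_Δ_neg
      W hΔ hc₀
  set θ := RatClosure.torsionEquiv (K := K) W ((2 : ℕ) : ℤ) with hθ
  have hv : ht.torsionMap W ((2 : ℕ) : ℤ) (θ v₀) ≠ θ v₀ := by
    rw [← RatClosure.torsionEquiv_smul_of_lift W ht c₀ (fun _ ↦ rfl) ((2 : ℕ) : ℤ) v₀]
    exact fun h ↦ hv₀ (θ.injective h)
  have hdvd : ((2 : ℕ) : ℤ) ∣ ((2 ^ M : ℕ) : ℤ) := Int.natCast_dvd_natCast.mpr h2dvd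
  set v₁ : geomTorsion (W.baseChange K) ((2 ^ M : ℕ) : ℤ) :=
    AddSubgroup.inclusion ((W.baseChange K).geomTorsion_le_of_dvd hdvd) (θ v₀) with hv₁
  have hv₁coe : (v₁ : geomPoints (W.baseChange K)) = (θ v₀ : geomPoints (W.baseChange K)) := rfl
  have hv₁2 : ((2 : ℕ) : ℤ) • v₁ = 0 := by
    apply Subtype.ext
    rw [AddSubgroupClass.coe_zsmul, hv₁coe]
    exact (mem_geomTorsion_iff _ _ _).mp (θ v₀).2
  have hv₁τ' : ∀ {μ : ℤ}, (μ = 1 ∨ μ = -1) → μ • ht.torsionMap W ((2 ^ M : ℕ) : ℤ) v₁ + v₁ ≠ 0 := by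
    intro μ hμ h
    have h2 : (2 : ℤ) • v₁ = 0 := by exact_mod_cast hv₁2
    have hτ2 : (2 : ℤ) • ht.torsionMap W ((2 ^ M : ℕ) : ℤ) v₁ = 0 := by rw [← map_zsmul, h2, map_zero]
    have hμfix : μ • ht.torsionMap W ((2 ^ M : ℕ) : ℤ) v₁ = ht.torsionMap W ((2 ^ M : ℕ) : ℤ) v₁ := by
      rcases hμ with rfl | rfl
      · rw [one_zsmul]
      · rw [two_zsmul] at hτ2; rw [neg_one_zsmul]; exact neg_eq_of_add_eq_zero_left hτ2
    rw [hμfix] at h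
    apply hv
    apply Subtype.ext
    rw [two_zsmul] at h2
    have h' : ht.torsionMap W ((2 ^ M : ℕ) : ℤ) v₁ = v₁ := by
      rw [eq_neg_of_add_eq_zero_left h, neg_eq_of_add_eq_zero_left h2]
    have h'' := congrArg (fun R : geomTorsion (W.baseChange K) ((2 ^ M : ℕ) : ℤ) ↦
      (R : geomPoints (W.baseChange K))) h'
    simpa only [IsLiftOfAut.coe_torsionMap, hv₁coe] using h''
  -- `R ∈ E[2^M]` with `2^{M-1} R = v₁`
  obtain ⟨R₀, hR₀⟩ := (W.baseChange K).zsmul_geomPoints_surjective_holds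
    (n := ((2 ^ (M - 1) : ℕ) : ℤ)) (by exact_mod_cast pow_ne_zero (M - 1) two_ne_zero)
    (v₁ : geomPoints (W.baseChange K))
  have hR₀' : ((2 ^ (M - 1) : ℕ) : ℤ) • R₀ = (v₁ : geomPoints (W.baseChange K)) := hR₀
  have hRmem : R₀ ∈ geomTorsion (W.baseChange K) ((2 ^ M : ℕ) : ℤ) := by
    rw [mem_geomTorsion_iff]
    have e1 : ((2 ^ M : ℕ) : ℤ) = ((2 : ℕ) : ℤ) * ((2 ^ (M - 1) : ℕ) : ℤ) := by
      rw [← Nat.cast_mul]; congr 1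
      conv_lhs => rw [show M = M - 1 + 1 by omega, pow_succ, mul_comm]
    rw [e1, mul_smul, hR₀', ← AddSubgroupClass.coe_zsmul, hv₁2]; rfl
  set Rq : geomTorsion (W.baseChange K) ((2 ^ M : ℕ) : ℤ) := ⟨R₀, hRmem⟩ with hRq
  have hRq : (((2 : ℕ) : ℤ) ^ (M - 1)) • Rq = v₁ := by
    apply Subtype.ext
    rw [AddSubgroupClass.coe_zsmul, ← Nat.cast_pow]
    exact hR₀'
  set tc : geomTorsion (W.baseChange K) ((2 ^ M : ℕ) : ℤ) := (((2 : ℕ) : ℤ) ^ (M - a - 1)) • Rq with htc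
  have htca : (((2 : ℕ) : ℤ) ^ a) • tc = v₁ := by
    rw [htc, smul_smul, ← pow_add, show a + (M - a - 1) = M - 1 by omega, hRq]
  have htc0 : (((2 : ℕ) : ℤ) ^ ec) • tc = 0 := by
    obtain ⟨d, hd⟩ := Nat.exists_eq_add_of_le heca
    rw [hd, show a + 1 + d = d + 1 + a by omega, pow_add, ← smul_smul, htca, pow_succ, ← smul_smul,
      hv₁2]; exact smul_zero _
  -- ### FIRST PRIME: `s_{λ₁} = 0`, `(2^a c(1))_{λ₁} ≠ 0`
  obtain ⟨ℓ₁, -, hℓ₁, hℓ₁N, hℓ₁D, hℓ₁2, hprime₁, hfrob₁, F₁, hF₁, hval₁, hloc₁⟩ :=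
    KolyvaginImageTwo.exists_kolyvaginPrime_gt_two_pow_of_targets hC (N := N) W hK hρ hΔK hc hc₀ hM
      hzfix hcomm ![s, cl 1] id ![ε₀, ε₀] (fun i ↦ by fin_cases i; exacts [hsε, hx1]) ![es, ec]
      (fun i ↦ by fin_cases i; exacts [by simpa using hes, by simpa using hec]) hind2
      ![0, tc] (fun i ↦ by fin_cases i; exacts [zsmul_zero _, by simpa using htc0]) 0
  have hℓ₁K : IsKolyvaginPrime N W K 2 ℓ₁ :=
    ⟨hℓ₁, hℓ₁N, hℓ₁D, hℓ₁2, hprime₁, FrobEqFrobInfty.of_dvd h2dvd hfrob₁⟩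
  have hsker₁ : s ∈ (W.baseChange K).torsionLocalKer (hℓ₁K.place.adicCompletion K) ((2 ^ M : ℕ) : ℤ) := by
    have h0 := hval₁ 0
    simp only [Matrix.cons_val_zero, id_eq, map_zero, zsmul_zero, add_zero] at h0
    exact (hloc₁ s (AddSubgroup.subset_closure ⟨0, rfl⟩) _ hℓ₁K.mem_place).mpr h0
  have hxker₁ : (((2 : ℕ) : ℤ) ^ a) • cl 1 ∉
      (W.baseChange K).torsionLocalKer (hℓ₁K.place.adicCompletion K) ((2 ^ M : ℕ) : ℤ) := by
    have h1 := hval₁ 1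
    simp only [Matrix.cons_val_one, Matrix.cons_val_zero, id_eq] at h1
    have hxmem : (((2 : ℕ) : ℤ) ^ a) • cl 1 ∈ AddSubgroup.closure (Set.range ![s, cl 1]) :=
      AddSubgroup.zsmul_mem _ (AddSubgroup.subset_closure (Set.mem_range.mpr ⟨1, rfl⟩)) _
    rw [hloc₁ _ hxmem _ hℓ₁K.mem_place, h1Eval_zsmul _ _ _ _ hF₁, h1, zsmul_add, smul_comm,
      ← map_zsmul, htca]
    exact hv₁τ' hε₀
  -- ### `2^a c(ℓ₁)` is not Selmer at `λ₁`, hence non-zero; `c(ℓ₁)` is `(−ε)`-eigen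
  have hkol₁ : ∀ q' ∈ ℓ₁.primeFactors, IsKolyvaginPrime N W K 2 q' ∧ FrobEqFrobInfty W K (2 ^ M) q' := by
    intro q' hq'
    rw [hℓ₁.primeFactors, Finset.mem_singleton] at hq'
    exact hq' ▸ ⟨hℓ₁K, hfrob₁⟩
  obtain ⟨h541₁, -, hdloc₁⟩ := hrel ℓ₁ hℓ₁.squarefree hkol₁
  have hd₁0 : (((2 : ℕ) : ℤ) ^ a) • cl ℓ₁ ≠ 0 := by
    intro h0
    have h := hdloc₁ ℓ₁ hℓ₁ dvd_rfl hℓ₁K.place hℓ₁K.mem_place a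
    rw [← hcl ℓ₁, ← hcl (ℓ₁ / ℓ₁), Nat.div_self hℓ₁.pos, h0] at h
    exact hxker₁ (h.mp (AddSubgroup.zero_mem _))
  have hd₁eig : conjAct W c _ (cl ℓ₁) = (-ε₀) • cl ℓ₁ := by
    have h := conjAct_kolyvaginClass_eq_smul W (hdiv := hdiv) hτ (hA ℓ₁) (hAτ ℓ₁) (hPt ℓ₁) _ h541₁
    rw [← hcl ℓ₁, hℓ₁.primeFactors, Finset.card_singleton, pow_one, mul_neg_one] at h
    exact h
  -- ### bottom bits `u₂ = 2^j w`, `x₂ = 2^i · 2^a c(ℓ₁)` (both `c_*`-fixed)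
  obtain ⟨j, -, hu0, hu2⟩ :=
    exists_two_pow_zsmul_ne_zero_two_zsmul_eq_zero M (z := (((2 : ℕ) : ℤ) ^ (M - a)) • s)
      (hqkill _) hw
  obtain ⟨i, hi, hxi0, hxi2⟩ :=
    exists_two_pow_zsmul_ne_zero_two_zsmul_eq_zero (M - a) (z := (((2 : ℕ) : ℤ) ^ a) • cl ℓ₁)
      (by rw [smul_smul, ← pow_add, show M - a + a = M by omega, hqkill]) hd₁0
  set u₂ : galH1Torsion (W.baseChange K) ((2 ^ M : ℕ) : ℤ) :=
    (((2 : ℕ) : ℤ) ^ j) • ((((2 : ℕ) : ℤ) ^ (M - a)) • s) with hu₂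
  set x₂ : galH1Torsion (W.baseChange K) ((2 ^ M : ℕ) : ℤ) :=
    (((2 : ℕ) : ℤ) ^ i) • ((((2 : ℕ) : ℤ) ^ a) • cl ℓ₁) with hx₂
  have hu₂fix : conjAct W c _ u₂ = (1 : ℤ) • u₂ := by
    rw [one_zsmul, hu₂, map_zsmul, map_zsmul, hsε, smul_comm (((2 : ℕ) : ℤ) ^ (M - a)) ε₀,
      smul_comm (((2 : ℕ) : ℤ) ^ j) ε₀]
    exact hsignfix hε₀ _ hu2
  have hx₂fix : conjAct W c _ x₂ = (1 : ℤ) • x₂ := by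
    have hν : (-ε₀) = 1 ∨ (-ε₀) = -1 := by rcases hε₀ with rfl | rfl <;> simp
    rw [one_zsmul, hx₂, map_zsmul, map_zsmul, hd₁eig, smul_comm (((2 : ℕ) : ℤ) ^ a) (-ε₀),
      smul_comm (((2 : ℕ) : ℤ) ^ i) (-ε₀)]
    exact hsignfix hν _ hxi2
  -- ### SECOND PRIME `ℓ₂ > ℓ₁`: `u_{2,λ₂} ≠ 0`, `x_{2,λ₂} ≠ 0`
  obtain ⟨ℓ₂, hℓ₁₂, hℓ₂K, hfrob₂, hux⟩ : ∃ ℓ₂ : ℕ, ℓ₁ < ℓ₂ ∧ IsKolyvaginPrime N W K 2 ℓ₂ ∧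
      FrobEqFrobInfty W K (2 ^ M) ℓ₂ ∧
      ∀ v : HeightOneSpectrum (𝓞 K), (ℓ₂ : 𝓞 K) ∈ v.asIdeal →
        u₂ ∉ (W.baseChange K).torsionLocalKer (v.adicCompletion K) ((2 ^ M : ℕ) : ℤ) ∧
          x₂ ∉ (W.baseChange K).torsionLocalKer (v.adicCompletion K) ((2 ^ M : ℕ) : ℤ) := by
    by_cases hux : u₂ = x₂
    · obtain ⟨ℓ, hbℓ, hℓ, hℓN, hℓD, hℓ2, hprime, hfrob, F, hF, hval, hloc⟩ :=
        KolyvaginImageTwo.exists_kolyvaginPrime_gt_two_pow_of_targets hC (N := N) W hK hρ hΔK hc hc₀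
          hM hzfix hcomm ![x₂] id (fun _ ↦ 1) (fun i ↦ by fin_cases i; exact hx₂fix) (fun _ ↦ 1)
          (fun i ↦ by fin_cases i; simpa using hxi2) (pow_one_dvd_of_sum_one hxi2 hxi0)
          (fun _ ↦ v₁) (fun _ ↦ by rw [pow_one]; exact hv₁2) ℓ₁
      refine ⟨ℓ, hbℓ, ⟨hℓ, hℓN, hℓD, hℓ2, hprime, FrobEqFrobInfty.of_dvd h2dvd hfrob⟩, hfrob,
        fun v hv ↦ ?_⟩
      have h0 := hval 0; simp only [Matrix.cons_val_zero] at h0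
      have h1 : x₂ ∉ (W.baseChange K).torsionLocalKer (v.adicCompletion K) ((2 ^ M : ℕ) : ℤ) := by
        rw [hloc x₂ (AddSubgroup.subset_closure ⟨0, rfl⟩) v hv, h0]
        exact hv₁τ' (Or.inl rfl)
      exact ⟨hux ▸ h1, h1⟩
    · obtain ⟨ℓ, hbℓ, hℓ, hℓN, hℓD, hℓ2, hprime, hfrob, F, hF, hval, hloc⟩ :=
        KolyvaginImageTwo.exists_kolyvaginPrime_gt_two_pow_of_targets hC (N := N) W hK hρ hΔK hc hc₀
          hM hzfix hcomm ![u₂, x₂] id (fun _ ↦ 1)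
          (fun i ↦ by fin_cases i; exacts [hu₂fix, hx₂fix]) (fun _ ↦ 1)
          (fun i ↦ by fin_cases i <;> simpa using (by first | exact hu2 | exact hxi2))
          (pow_one_dvd_of_sum_two hu2 hxi2 hu0 hxi0 hux)
          (fun _ ↦ v₁) (fun _ ↦ by rw [pow_one]; exact hv₁2) ℓ₁
      refine ⟨ℓ, hbℓ, ⟨hℓ, hℓN, hℓD, hℓ2, hprime, FrobEqFrobInfty.of_dvd h2dvd hfrob⟩, hfrob,
        fun v hv ↦ ?_⟩
      have h0 := hval 0
      have h1 := hval 1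
      simp only [Matrix.cons_val_zero, Matrix.cons_val_one] at h0 h1
      refine ⟨?_, ?_⟩
      · rw [hloc u₂ (AddSubgroup.subset_closure ⟨0, rfl⟩) v hv, h0]; exact hv₁τ' (Or.inl rfl)
      · rw [hloc x₂ (AddSubgroup.subset_closure ⟨1, rfl⟩) v hv, h1]; exact hv₁τ' (Or.inl rfl)
  have hℓ₂ : ℓ₂.Prime := hℓ₂K.prime; have hne : ℓ₁ ≠ ℓ₂ := Nat.ne_of_lt hℓ₁₂
  -- ### the class `d = c(ℓ₁ℓ₂)`: `ε`-eigen, Selmer off `ℓ₁ℓ₂`, `2^{i+a} d` NOT Selmer at `λ₂`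
  have hsqf : Squarefree (ℓ₁ * ℓ₂) :=
    (Nat.squarefree_mul ((Nat.coprime_primes hℓ₁ hℓ₂).mpr hne)).mpr ⟨hℓ₁.squarefree, hℓ₂.squarefree⟩
  have hpf : (ℓ₁ * ℓ₂).primeFactors = {ℓ₁, ℓ₂} := by
    rw [Nat.primeFactors_mul hℓ₁.ne_zero hℓ₂.ne_zero, hℓ₁.primeFactors, hℓ₂.primeFactors,
      ← Finset.insert_eq]
  have hkol₁₂ : ∀ q' ∈ (ℓ₁ * ℓ₂).primeFactors,
      IsKolyvaginPrime N W K 2 q' ∧ FrobEqFrobInfty W K (2 ^ M) q' := by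
    intro q' hq'
    rw [hpf, Finset.mem_insert, Finset.mem_singleton] at hq'
    rcases hq' with rfl | rfl
    exacts [⟨hℓ₁K, hfrob₁⟩, ⟨hℓ₂K, hfrob₂⟩]
  obtain ⟨h541₂, hdsel₂, hdloc₂⟩ := hrel (ℓ₁ * ℓ₂) hsqf hkol₁₂
  have hdeig : conjAct W c _ (cl (ℓ₁ * ℓ₂)) = ε₀ • cl (ℓ₁ * ℓ₂) := by
    have h := conjAct_kolyvaginClass_eq_smul W (hdiv := hdiv) hτ (hA (ℓ₁ * ℓ₂)) (hAτ _) (hPt _) _ h541₂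
    rw [← hcl (ℓ₁ * ℓ₂), hpf, Finset.card_pair hne] at h
    simpa using h
  have hdsel' : ∀ v : HeightOneSpectrum (𝓞 K), v ≠ hℓ₁K.place → (ℓ₂ : 𝓞 K) ∉ v.asIdeal →
      cl (ℓ₁ * ℓ₂) ∈ selmerLocalKer (W.baseChange K) (v.adicCompletion K) ((2 ^ M : ℕ) : ℤ) := by
    intro v hv1 hv2
    rw [hcl (ℓ₁ * ℓ₂)]
    refine hdsel₂ v fun hmem ↦ ?_
    rcases natCast_mul_mem_asIdeal (K := K) hmem with h | h
    · exact hv1 (hℓ₁K.mem_iff.mp h)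
    · exact hv2 h
  have hx₂eq : x₂ = (((2 : ℕ) : ℤ) ^ (i + a)) • cl ℓ₁ := by rw [hx₂, smul_smul, ← pow_add]
  have hdv : (((2 : ℕ) : ℤ) ^ (i + a)) • cl (ℓ₁ * ℓ₂) ∉
      selmerLocalKer (W.baseChange K) (hℓ₂K.place.adicCompletion K) ((2 ^ M : ℕ) : ℤ) := by
    intro hmem
    have h := hdloc₂ ℓ₂ hℓ₂ (dvd_mul_left ℓ₂ ℓ₁) hℓ₂K.place hℓ₂K.mem_place (i + a)
    rw [← hcl (ℓ₁ * ℓ₂), ← hcl (ℓ₁ * ℓ₂ / ℓ₂), Nat.mul_div_cancel ℓ₁ hℓ₂.pos] at h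
    exact (hux hℓ₂K.place hℓ₂K.mem_place).2 (hx₂eq ▸ h.mp hmem)
  have hdinf : ∀ w : InfinitePlace K,
      cl (ℓ₁ * ℓ₂) ∈ selmerLocalKer (W.baseChange K) w.Completion ((2 ^ M : ℕ) : ℤ) := fun w ↦ by
    haveI : IsAlgClosed w.Completion := isAlgClosed_of_ringEquiv
      (InfinitePlace.Completion.ringEquivComplexOfIsComplex (IsTotallyComplex.isComplex w)).symm
    rw [WeierstrassCurve.selmerLocalKer_eq_top_of_isAlgClosed]; trivial
  have hgood : (W.baseChange K).HasGoodReductionAt hℓ₂K.place := by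
    simpa [WeierstrassCurve.mem_badPlaces_iff] using IsKolyvaginPrime.not_mem_badPlaces (W := W) hP hℓ₂K
  -- ### reciprocity at `ℓ₂` with `T = {λ₁}` and leaf (B) at `2^M`
  obtain ⟨B, _, e, halt, hnd, hRe⟩ := hRT hℓ₂K hfrob₂
  have hfin := lemma_5_3_descent_two_pow W hK hc hΔ hℓ₂K hM (q := 2 ^ M) rfl hfrob₂ hgood e halt hnd
    hε₀ hdeig hdv hs
    (fun 𝔔 h𝔔 F hF hFT σ hσ ↦ hRe {hℓ₁K.place} s hs
      (fun v hv ↦ by rw [Finset.mem_singleton] at hv; rw [hv]; exact hsker₁) (cl (ℓ₁ * ℓ₂))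
      (fun v hvT hv ↦ hdsel' v (fun h ↦ hvT (by rw [h]; exact Finset.mem_singleton_self _)) hv)
      hdinf 𝔔 h𝔔 F hF hFT σ hσ)
  rw [hsε, smul_smul, hεε, one_smul] at hfin
  -- ### `u₂ = 2^{j+i} · 2^{M-i-a-1}(s + s) ∈ ker loc_{λ₂}`: contradiction
  have hkey : u₂ = (((2 : ℕ) : ℤ) ^ (j + i)) • ((((2 : ℕ) : ℤ) ^ (M - (i + a) - 1)) • (s + s)) := by
    rw [hu₂, smul_smul, smul_smul, ← two_zsmul, smul_smul]
    congr 1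
    rw [show (2 : ℤ) = ((2 : ℕ) : ℤ) by norm_num, mul_assoc, ← pow_succ, ← pow_add, ← pow_add]
    congr 1
    omega
  apply (hux hℓ₂K.place hℓ₂K.mem_place).1
  rw [hkey]
  exact AddSubgroup.zsmul_mem _ hfin _

end Summit.BirchSwinnertonDyer.BirchSwinnertonDyer.Theorems.KolyvaginDescentTwo

end
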